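import Literature.AlgebraicGeometry.Resolution.AbhyankarSimplePoints
import Literature.AlgebraicGeometry.Resolution.AbhyankarBasesTransport
import Literature.AlgebraicGeometry.Resolution.AbhyankarBases
import Literature.AlgebraicGeometry.Resolution.AbhyankarToroidalChartsProofs
import Literature.AlgebraicGeometry.Resolution.ResidueSeparableCompositum
import Literature.AlgebraicGeometry.Resolution.InseparableLocalUniformizationAbhyankar
import Literature.AlgebraicGeometry.Resolution.InseparableLocalUniformizationDefectStep
import Literature.AlgebraicGeometry.Resolution.SmoothUniformization
import HarnessLib

/-!
# Inseparable local uniformization of Abhyankar valuations: Thm. 5.5.2 (i) of Temkin 2013 assembled from §5 — proved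

Topic: `Literature/AlgebraicGeometry/Resolution`. M. Temkin, *Inseparable local uniformization*,
J. Algebra 373 (2013) 65–119 = arXiv:0804.1554v3 (numbers and pages of this version). The named
fact `Temkin2013Abhyankar` (`InseparableLocalUniformizationAbhyankar.lean`) is Thm. 5.5.2 (i) for ONE
finite extension `K₁/K` (`n = 1`), logarithmic data dropped: for a finitely generated Abhyankar
valued `k`-field `K` (`D_{K/k} = 0`), an affine `k`-model `X = Spec A` of `K°` and a finite extension
of valued fields `K₁/K`, there are a finite purely inseparable `l/k` and an affine refinement
`X' = Spec A'` of `X` such that the centre of `(lK₁)°` on `Nr_{lK₁}(X')` is a simple `l`-smooth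
(regular) point. It is the base `D = 0` of the induction on the transcendence defect in the proof
of Thm. 4.1.1 (`Temkin2013Abhyankar.descentAbhyankar : Temkin2013Abhyankar →
Temkin2013DescentAbhyankar`, PROVED there). This file PROVES

* `Temkin2013Abhyankar.of_section5 : Temkin2013_Thm553 → Temkin2013_Thm551iii → Temkin2013Abhyankar`,

the printed proof of Thm. 5.5.2 (pp. 60–61) for `n = 1`, from the two results of §5.5 it quotes
that are still named facts (`AbhyankarToroidalCharts.lean`: Thm. 5.5.3 — residual separability
after a purely inseparable extension of the constants; Thm. 5.5.1 (iii) — the adapted toroidal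
model is étale over its toric chart) and the PROVED Prop. 5.4.3 (`Temkin2013_Prop543_holds`,
`AbhyankarToroidalChartsProofs.lean`), Cor. 5.4.2 (`ToricChartsExhaustion.lean`), Thm. A.2.1
(`PerronTransforms.lean`), Remark 2.1.3 (`AbhyankarInvariants.lean`), the Abhyankar bases of
`AbhyankarBases.lean` / `AbhyankarBasesTransport.lean` and the bricks of
`AbhyankarSimplePoints.lean`. Hence the corollaries `Temkin2013DescentAbhyankar.of_section5`,
`Temkin2013Descent.of_section5`, `Temkin2013Relative.of_section5_frontier`,
`Temkin2013.of_section5_frontier`, `Temkin2013HeightLeOne.of_section5_frontier`: the frontier of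
the corrected Thm. 1.3.2 (`Temkin2013Relative`) becomes `{Temkin2013_Thm553, Temkin2013_Thm551iii,
Temkin2013DescentDefectStep (§4.1, Steps 1–4), Temkin2013HeightStepOfDescent (§4.2)}` — statements
printed in the paper with their own numbers.

## The proof (pp. 60–61, `n = 1`) and its rendering

1. `K₁/k` is finitely generated and Abhyankar (`transcendenceDefect_le_of_isAlgebraic`).
2. "(a) there exists a finite purely inseparable extension `l/k` such that all fields `lK̃ᵢ` are
   separable over `l` … Fix `l` as in (a), then it suffices to prove the Theorem for `l`, `L = lK`":
   Thm. 5.5.3 for `K₁` in compositum form (`exists_compositum_of_thm553`): `L₁ = lK₁ ⊇ K₁` finite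
   purely inseparable, `l ≤ L₁`, and for the valuation ring `L₁°` over `K₁°` (Chevalley,
   `exists_valuationSubring_comap_eq`) a finite separating transcendence basis `s` of `L̃₁/l`;
   `D_{L₁/l} = 0` (`transcendenceDefect_eq_of_isAlgebraic_constants`).
3. "Find an Abhyankar transcendence basis … as in Theorem 5.5.1 (iii)" — `B' ⊂ L₁` adapted to `s`
   and to a `ℤ`-basis of `Λ₁ = |L₁^×|` (`exists_adapted_isAbhyankarBasis`); "Notice that `B` is an
   Abhyankar basis of each `Kᵢ`" — `B ⊂ K`, an Abhyankar basis of `(L₁, L₁°)` over `l`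
   (`exists_isAbhyankarBasis`, `IsAbhyankarBasis.extension`, `IsAbhyankarBasis.of_isAlgebraic_constants`).
4. "find a sufficiently large toric monoid `M̄`": thresholds `M₁` (Prop. 5.4.3 for `B`, `B'`), `M₂`
   (Thm. 5.5.1 (iii) for `B'`), `M₃` (Cor. 5.4.2: the generators of `A` lie in `A_{B,M}`); "By
   Theorem A.2.1, there exists a free monoid … Replacing `M̄` with the larger toric monoid" — the free
   monoid `M` on a `ℤ`-basis of `Λ₁` inside `Λ₁°` containing them (`exists_basis_lt_one_subset_closure`,
   `isToricMonoid_closure_basis`).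
5. "`X₁ = Nr_{K₁}(A_{B,M̄})` … `x₁` is a regular point and, since `k(x₁) ⊂ K̃₁` is separable over
   `k`, `x₁` is even a simple `k`-smooth point": on the `B'`-side the free chart
   `l[M_{B'}] = l[z, y'][1/∏ y'ᵢ]` is formally smooth, `Nr_{L₁}` of it is finite over it, the residue
   field of the centre on the chart is `l(ȳ') = l(s)`, and `Nr_{L₁}(l[M_{B'}])` is étale over the
   chart at the centre (Thm. 5.5.1 (iii)); hence the centre is an `l`-smooth point with residue field
   separable over `l` (`isSmoothAt_and_formallySmooth_residueField_of_isEtaleAt`). By Prop. 5.4.3 the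
   local rings of the centres on `Nr_{L₁}(l[M_B])` and `Nr_{L₁}(l[M_{B'}])` coincide, so the same
   holds on the `B`-side (`isSmoothAt_centreIdeal_of_eq`, `formallySmooth_residueField_centreIdeal_of_eq`).
   (For `n = 1` only the point `x₁` matters, and Prop. 5.4.3 replaces the log-smoothness detour
   through Thm. 5.5.1 (i).)
6. "It remains to achieve … that `X'` admits a morphism to `X` … we rechoose `M̄` so that …
   `A ⊂ A_{B,M̄}`", and "any refinement `X'_L → X_L` of normal affine `l`-models of `L°` is the
   `L`-normalization of a refinement `X' → X` of affine `k`-models of `K°`": the affine refinement is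
   `A' = k[A, y, y⁻¹, x^{d₁}, …, x^{dₙ}] ⊆ K°` where `|x^{dᵢ}| = bᵢ^{nᵢ}` is a power of the `i`-th
   free generator of `M` lying in `Λ_B` (finite index, `IsAbhyankarBasis.exists_pow_mem_closure`);
   then `N = Nr_{L₁}(A')` (E. Noether, `exists_normalisation_in_extension`) has the same local ring at
   the centre as `Nr_{L₁}(l[M_B])`: `A' ⊆ A_{B,M}` (Cor. 5.4.2 for the generators of `A`),
   `N ⊆ A_{B,M}` (the local ring of a normal model is integrally closed in `L₁`,
   `mem_centreLocalRing_of_isIntegral`), and `l[M_B] ⊆ N` (every monomial of `l[M_B]` has its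
   `∏ nᵢ`-th power in `A'`).
7. Regularity of the local ring: smooth over a field ⇒ regular (`isRegularLocalRing_of_isSmoothAt`,
   `SmoothImpliesRegular.lean`), `N` being finitely generated over `l`.

## Sources

* M. Temkin, *Inseparable local uniformization*, arXiv:0804.1554v3: proof of Thm. 4.1.1, Step 0
  (p. 47); §5.1 (p. 51); §5.3 (pp. 54–56); §5.4, Cor. 5.4.2, Prop. 5.4.3 (pp. 56–59); Thm. 5.5.1,
  Thm. 5.5.2 and its proof, Thm. 5.5.3 (pp. 59–61); Thm. A.2.1 (p. 63).
-/

noncomputable section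

namespace Literature.AlgebraicGeometry.Resolution

open IsLocalRing ValuationSubring

universe u

/-! ### A lemma on local rings -/


section Lemmas

variable {l L : Type u} [Field l] [Field L] [Algebra l L] (O : ValuationSubring L)

/-- The local ring construction is idempotent: `(N_𝔭)_𝔭 = N_𝔭` inside `L`. [folklore] -/
theorem centreLocalRing_centreLocalRing (N : Subalgebra l L) :
    centreLocalRing O (centreLocalRing O N) = centreLocalRing O N := by
  refine le_antisymm ?_ (le_centreLocalRing _)
  rintro _ ⟨a, ⟨a₁, ha₁, a₂, ha₂, ha₂1, rfl⟩, b, ⟨b₁, hb₁, b₂, hb₂, hb₂1, rfl⟩, hb1, rfl⟩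
  have hb₁1 : O.valuation b₁ = 1 := by
    rw [map_div₀, hb₂1, div_one] at hb1
    exact hb1
  have ha₂0 : a₂ ≠ 0 := fun h => by simp [h] at ha₂1
  have hb₂0 : b₂ ≠ 0 := fun h => by simp [h] at hb₂1
  have hb₁0 : b₁ ≠ 0 := fun h => by simp [h] at hb₁1
  refine ⟨a₁ * b₂, N.mul_mem ha₁ hb₂, a₂ * b₁, N.mul_mem ha₂ hb₁,
    by rw [map_mul, ha₂1, hb₁1, mul_one], ?_⟩
  field_simp

end Lemmas


/-! ### Thm. 5.5.2 (i), `n = 1`, from §5 -/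

-- one long proof through the fields `k ⊆ K ⊆ K₁ ⊆ L₁ ⊇ l ⊇ k`, two Abhyankar bases, three monoid thresholds
-- and three affine models: the whole elaboration needs four times the default budget (no single step is expensive)
set_option maxHeartbeats 800000 in
/-- **Temkin 2013, Thm. 5.5.2 (i) for `n = 1` (logarithmic data dropped), from §5** (proof of
Thm. 5.5.2, pp. 60–61: "(a) there exists a finite purely inseparable extension `l/k` such that all
fields `lK̃ᵢ` are separable over `l` … Fix `l` as in (a), then it suffices to prove the Theorem for
`l`, `L = lK`, `X_L = Nr_L(X)` and `L₁, …, L_n` … Find an Abhyankar transcendence basis `B` of `K`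
as in Theorem 5.5.1 (iii) and set `K_B = k(B)`. Notice that `B` is an Abhyankar basis of each `Kᵢ`,
hence we can apply 5.5.1 (iii) to `B` and `K` and 5.5.1 (ii) (resp. 5.5.1 (i)) to `B` and `Kᵢ`'s
… to find a sufficiently large toric monoid `M̄ ⊂ |K°_B|` which matches `B`, `K` and all `Kᵢ`'s …
Define `X'` to be the normalization of `A = A_{B,M̄}` in `K` … `Xᵢ = Nr_{Kᵢ}(A_{B,M̄})` … By
Theorem A.2.1, there exists a free monoid `M₁ ⊂ Λ°₁` which contains the saturation of `M̄` in
`Λ°₁`. Replacing `M̄` with the larger toric monoid `M₁ ∩ Λ̄°` … `x₁` is a regular point and, since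
`k(x₁) ⊂ K̃₁` is separable over `k`, `x₁` is even a simple `k`-smooth point. It remains to achieve,
in addition to all the above properties, that `X'` admits a morphism to `X` … By Corollary 5.4.2
taking a sufficiently large `M̄` we can also achieve that the local ring `A_{B,M̄}` of `x'` contains
any finite subset of `K°` … we rechoose `M̄` so that … `A ⊂ A_{B,M̄}`"). PROVED from the named
facts `Temkin2013_Thm553` (Thm. 5.5.3) and `Temkin2013_Thm551iii` (Thm. 5.5.1 (iii)) of
`AbhyankarToroidalCharts.lean` and the proved `Temkin2013_Prop543_holds` (Prop. 5.4.3); see the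
module docstring for the step-by-step dictionary.
[cite: Temkin2013, Thm. 5.5.2 (i) and its proof (pp. 60–61 of arXiv:0804.1554v3)] -/
theorem Temkin2013Abhyankar.of_section5 (h553 : Temkin2013_Thm553.{u})
    (h551 : Temkin2013_Thm551iii.{u}) : Temkin2013Abhyankar.{u} := by
  have h543 : Temkin2013_Prop543.{u} := Temkin2013_Prop543_holds
  intro k K _ _ _ hfg O hk hD A hAO hAfg hAfr K₁ _ _ hfin₁ O₁ hO₁
  classical
  haveI := hfin₁
  ------------------------------------------------------------------
  -- Step 0: `K₁` as a finitely generated Abhyankar valued `k`-field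
  ------------------------------------------------------------------
  letI : Algebra k K₁ := ((algebraMap K K₁).comp (algebraMap k K)).toAlgebra
  haveI : IsScalarTower k K K₁ := IsScalarTower.of_algebraMap_eq fun _ => rfl
  have hNK : Algebra.trdeg k K < Cardinal.aleph0 := trdeg_lt_aleph0_of_fg hfg
  have hfg₁ : (⊤ : IntermediateField k K₁).FG := intermediateField_fg_top_of_finiteDimensional hfg
  have hk₁ : ∀ c : k, algebraMap k K₁ c ∈ O₁ := fun c => by
    have : algebraMap k K c ∈ O₁.comap (algebraMap K K₁) := by rw [hO₁]; exact hk c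
    exact this
  haveI : Algebra.IsAlgebraic K K₁ := Algebra.IsAlgebraic.of_finite K K₁
  have hD₁ : transcendenceDefect k O₁ hk₁ = 0 :=
    Nat.le_zero.mp (hD ▸ transcendenceDefect_le_of_isAlgebraic O₁ O hO₁ hk₁ hk hNK)
  ------------------------------------------------------------------
  -- Step 1 (Thm. 5.5.3): the constant extension `l/k`, `L₁ = lK₁`, `L₁°`
  ------------------------------------------------------------------
  obtain ⟨L₁, _, _, _, _, hfinL, hpiL, l, hlfin, hlpi, hlK₁, H553⟩ :=
    exists_compositum_of_thm553 h553 k K₁ hfg₁ O₁ hk₁ hD₁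
  haveI := hfinL
  haveI := hpiL
  haveI := hlfin
  haveI := hlpi
  obtain ⟨O₁', hO₁'⟩ := exists_valuationSubring_comap_eq (Ω := L₁) O₁
  obtain ⟨hl, s, hs, hsep⟩ := H553 O₁' hO₁'
  -- algebra structures `k ⊆ K ⊆ K₁ ⊆ L₁`, `k ⊆ l ⊆ L₁`
  letI : Algebra K L₁ := ((algebraMap K₁ L₁).comp (algebraMap K K₁)).toAlgebra
  haveI : IsScalarTower K K₁ L₁ := IsScalarTower.of_algebraMap_eq fun _ => rfl
  haveI : IsScalarTower k K L₁ := IsScalarTower.of_algebraMap_eq fun c => by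
    rw [IsScalarTower.algebraMap_apply k K₁ L₁]; rfl
  haveI : FiniteDimensional K L₁ := Module.Finite.trans K₁ L₁
  haveI : Algebra.IsAlgebraic K L₁ := Algebra.IsAlgebraic.of_finite K L₁
  haveI : Algebra.IsAlgebraic K₁ L₁ := Algebra.IsAlgebraic.of_finite K₁ L₁
  have hkL : ∀ c : k, algebraMap k L₁ c ∈ O₁' := fun c => by
    have : algebraMap k K₁ c ∈ O₁'.comap (algebraMap K₁ L₁) := by rw [hO₁']; exact hk₁ c
    rw [ValuationSubring.mem_comap, ← IsScalarTower.algebraMap_apply] at this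
    exact this
  have hcomapK : O₁'.comap (algebraMap K L₁) = O := by
    rw [show algebraMap K L₁ = (algebraMap K₁ L₁).comp (algebraMap K K₁) from rfl,
      ← ValuationSubring.comap_comap, hO₁', hO₁]
  have hfgLk : (⊤ : IntermediateField k L₁).FG :=
    intermediateField_fg_top_of_finiteDimensional (F := K₁) (L := L₁) hfg₁
  have hfgL : (⊤ : IntermediateField l L₁).FG := IntermediateField.FG.of_restrictScalars (K := k) hfgLk
  have hNK₁ : Algebra.trdeg k K₁ < Cardinal.aleph0 := trdeg_lt_aleph0_of_fg hfg₁
  have hDLk : transcendenceDefect k O₁' hkL = 0 :=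
    Nat.le_zero.mp (hD₁ ▸ transcendenceDefect_le_of_isAlgebraic O₁' O₁ hO₁' hkL hk₁ hNK₁)
  have hDL : transcendenceDefect l O₁' hl = 0 := by
    rw [transcendenceDefect_eq_of_isAlgebraic_constants O₁' hkL hl]; exact hDLk
  have hDK' : transcendenceDefect k (O₁'.comap (algebraMap K L₁))
      (algebraMap_mem_comap_of_mem O₁' hkL) = 0 := by
    have key : ∀ (O' : ValuationSubring K) (h' : ∀ c : k, algebraMap k K c ∈ O'), O' = O →
        transcendenceDefect k O' h' = 0 := by
      rintro O' h' rfl; exact hD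
    exact key _ _ hcomapK
  ------------------------------------------------------------------
  -- Step 2: the Abhyankar bases `B' ⊂ L₁` (adapted, Thm. 5.5.1 (iii)) and `B ⊂ K`
  ------------------------------------------------------------------
  have hs_tb : letI := algebraOfMem l O₁' hl
      IsTranscendenceBasis l ((↑) : s → ResidueField O₁') := by
    letI := algebraOfMem l O₁' hl
    refine hs.isTranscendenceBasis_iff_isAlgebraic.mpr ?_
    haveI : Algebra.IsAlgebraic (IntermediateField.adjoin l (s : Set (ResidueField O₁')))
        (ResidueField O₁') := Algebra.IsSeparable.isAlgebraic _ _
    have h := (IntermediateField.isAlgebraic_adjoin_iff_top (F := l)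
      (s := (s : Set (ResidueField O₁'))) (S := ResidueField O₁')).mp this
    have key : ∀ S : Set (ResidueField O₁'), S = (s : Set (ResidueField O₁')) →
        Algebra.IsAlgebraic (Algebra.adjoin l S) (ResidueField O₁') := by
      rintro S rfl; exact h
    exact key _ Subtype.range_coe
  obtain ⟨E', x', y', hB', hgen', hrange'⟩ :=
    exists_adapted_isAbhyankarBasis O₁' hl hfgL hDL s hs_tb
  obtain ⟨E, F, xK, yK, hBKk0⟩ :=
    exists_isAbhyankarBasis (O₁'.comap (algebraMap K L₁)) (algebraMap_mem_comap_of_mem O₁' hkL) hfg hDK'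
  have hBK : IsAbhyankarBasis O₁' hl (fun j => algebraMap K L₁ (xK j))
      (fun i => comapInclusion O₁' (yK i)) :=
    (hBKk0.extension O₁' hkL hfg hDK').of_isAlgebraic_constants O₁' hkL hl
  set xL : Fin E → L₁ := fun j => algebraMap K L₁ (xK j) with hxLdef
  set yL : Fin F → O₁' := fun i => comapInclusion O₁' (yK i) with hyLdef
  have hsep' : letI := algebraOfMem l O₁' hl
      ∀ z : ResidueField O₁', IsSeparable
        (IntermediateField.adjoin l (Set.range fun i => residue O₁' (y' i))) z := by
    letI := algebraOfMem l O₁' hl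
    have key : ∀ S : Set (ResidueField O₁'), S = (s : Set (ResidueField O₁')) →
        ∀ z : ResidueField O₁', IsSeparable (IntermediateField.adjoin l S) z := by
      rintro S rfl z
      exact Algebra.IsSeparable.isSeparable _ z
    exact key _ hrange'
  ------------------------------------------------------------------
  -- Step 3: a free toric monoid `M ⊆ Λ°` large for Prop. 5.4.3, Thm. 5.5.1 (iii), Cor. 5.4.2
  ------------------------------------------------------------------
  obtain ⟨M₁, hM₁t, hM₁v, H543⟩ := h543 l L₁ hfgL O₁' hl hDL E F xL yL hBK E' s.card x' y' hB'
  obtain ⟨M₂, hM₂t, hM₂v, H551⟩ := h551 l L₁ hfgL O₁' hl hDL E' s.card x' y' hB' hgen' hsep'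
  obtain ⟨T, hT⟩ := hAfg
  set Z : Finset L₁ := T.image (algebraMap K L₁) with hZ
  have hTO : ∀ t ∈ T, t ∈ O := fun t ht => hAO (hT ▸ Algebra.subset_adjoin ht)
  have hZO : ∀ z ∈ Z, z ∈ O₁' := by
    intro z hz
    obtain ⟨t, ht, rfl⟩ := Finset.mem_image.mp hz
    have : t ∈ O₁'.comap (algebraMap K L₁) := by rw [hcomapK]; exact hTO t ht
    exact this
  obtain ⟨M₃, hM₃t, hM₃v, -, H542⟩ :=
    exists_isToricMonoid_forall_mem_centreLocalRing hfgL O₁' hl hDL xL yL hBK Z hZO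
  obtain ⟨S₁, hS₁⟩ := hM₁t.1
  obtain ⟨S₂, hS₂⟩ := hM₂t.1
  obtain ⟨S₃, hS₃⟩ := hM₃t.1
  have hSle : ∀ m ∈ S₁ ∪ S₂ ∪ S₃, m ≤ 1 := by
    intro m hm
    rw [← Units.val_le_val]
    rcases Finset.mem_union.mp hm with hm | hm
    · rcases Finset.mem_union.mp hm with hm | hm
      · exact hM₁v (hS₁ ▸ Submonoid.subset_closure hm)
      · exact hM₂v (hS₂ ▸ Submonoid.subset_closure hm)
    · exact hM₃v (hS₃ ▸ Submonoid.subset_closure hm)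
  haveI : Group.FG (ValueGroup O₁')ˣ := valueGroup_fg_of_transcendenceDefect_eq_zero O₁' hfgL hl hDL
  obtain ⟨n, b, -, hSsub, hle1⟩ := exists_basis_lt_one_subset_closure (S₁ ∪ S₂ ∪ S₃) hSle
  set M := Submonoid.closure (Set.range fun i => Additive.toMul (b i)) with hM
  have hMt : IsToricMonoid O₁' M := isToricMonoid_closure_basis O₁' b
  have hMv : M ≤ valuationMonoid O₁' := fun m hm =>
    (mem_valuationMonoid_iff O₁').mpr (Units.val_le_val.mpr (hle1 m hm))
  have hM₁M : M₁ ≤ M := by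
    rw [← hS₁, Submonoid.closure_le]
    exact fun m hm => hSsub (Finset.mem_union_left _ (Finset.mem_union_left _ hm))
  have hM₂M : M₂ ≤ M := by
    rw [← hS₂, Submonoid.closure_le]
    exact fun m hm => hSsub (Finset.mem_union_left _ (Finset.mem_union_right _ hm))
  have hM₃M : M₃ ≤ M := by
    rw [← hS₃, Submonoid.closure_le]
    exact fun m hm => hSsub (Finset.mem_union_right _ hm)
  obtain ⟨hLR, -⟩ := H543 M hMt hM₁M hMv
  have hEt := H551 M hMt hM₂M hMv
  have hAin := H542 M hM₃M
  ------------------------------------------------------------------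
  -- Step 4: the centre on `Nr(l[M_{B'}])` is a simple `l`-smooth point; transfer to `B`
  ------------------------------------------------------------------
  set C' := toricChart (k := l) O₁' x' y' M with hC'def
  have hC' : C'.toSubring ≤ O₁'.toSubring :=
    toricChart_le_valuationSubring x' y' hl hB'.valuation_eq_one hMv
  haveI : Algebra.FormallySmooth l C' := formallySmooth_toricChart_free O₁' hl x' y' hB' hgen' b
  haveI : Module.Finite C' (nrAlg C') := module_finite_nrAlg_toricChart_free O₁' hl x' y' hB' hgen' b hfgL
  have hres : Algebra.FormallySmooth l (centreIdeal C' O₁' hC').ResidueField :=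
    formallySmooth_residueField_centreIdeal_toricChart O₁' hl x' y' hB' hMv
  obtain ⟨hsm', hsepres'⟩ :=
    isSmoothAt_and_formallySmooth_residueField_of_isEtaleAt O₁' C' hC' hres hEt
  set CB := toricChart (k := l) O₁' xL yL M with hCBdef
  have hCB : CB.toSubring ≤ O₁'.toSubring :=
    toricChart_le_valuationSubring xL yL hl hBK.valuation_eq_one hMv
  set NB := nrAlg CB with hNBdef
  have hNB : NB.toSubring ≤ O₁'.toSubring := nrAlg_le_valuationSubring hCB
  have hsmB : Algebra.IsSmoothAt l (centreIdeal NB O₁' hNB) := isSmoothAt_centreIdeal_of_eq hLR hsm'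
  have hsepB : Algebra.FormallySmooth l (centreIdeal NB O₁' hNB).ResidueField :=
    formallySmooth_residueField_centreIdeal_of_eq hLR hsepres'
  ------------------------------------------------------------------
  -- Step 5: the affine refinement `X' = Spec A'` of `X` inside `K°`
  ------------------------------------------------------------------
  choose nI hnI hnImem using fun i : Fin n => hBK.exists_pow_mem_closure (Additive.toMul (b i))
  choose dI hdI using fun i : Fin n => exists_lmonomial_of_mem_closure O₁' xL hBK.ne_zero (hnImem i)
  let mK : Fin n → K := fun i => (dI i).prod fun j (n : ℤ) => xK j ^ n
  have hmKL : ∀ i, algebraMap K L₁ (mK i) = (dI i).prod fun j (n : ℤ) => xL j ^ n := fun i => by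
    simp only [mK, map_finsuppProd, map_zpow₀, hxLdef]
  have hbi1 : ∀ i, ((Additive.toMul (b i) : (ValueGroup O₁')ˣ) : ValueGroup O₁') ≤ 1 := fun i =>
    Units.val_le_val.mpr (hle1 _ (Submonoid.subset_closure ⟨i, rfl⟩))
  have hmKO : ∀ i, algebraMap K L₁ (mK i) ∈ O₁' := fun i => by
    rw [← O₁'.valuation_le_one_iff, hmKL, ← hdI]
    push_cast
    exact pow_le_one' (hbi1 i) _
  have hyK1 : ∀ i, (O₁'.comap (algebraMap K L₁)).valuation (yK i : K) = 1 := fun i =>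
    (valuation_comap_eq_one_iff O₁' (yK i : K)).mpr (hBK.valuation_eq_one i)
  have hyK0 : ∀ i, (yK i : K) ≠ 0 := fun i h => by simpa [h] using hyK1 i
  have hyKinv : ∀ i, (yK i : K)⁻¹ ∈ O := fun i => by
    rw [← hcomapK]
    exact ((valuation_eq_one_iff_mem_and_inv_mem _ (hyK0 i)).mp (hyK1 i)).2
  have hyKO : ∀ i, (yK i : K) ∈ O := fun i => by rw [← hcomapK]; exact (yK i).2
  set G : Finset K := T ∪ Finset.univ.image (fun i => (yK i : K)) ∪
    Finset.univ.image (fun i => (yK i : K)⁻¹) ∪ Finset.univ.image mK with hG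
  set A' : Subalgebra k K := Algebra.adjoin k (G : Set K) with hA'
  have hGmem : ∀ t : K, t ∈ G ↔ t ∈ T ∨ (∃ i, (yK i : K) = t) ∨ (∃ i, (yK i : K)⁻¹ = t) ∨
      ∃ i, mK i = t := fun t => by
    simp only [hG, Finset.mem_union, Finset.mem_image, Finset.mem_univ, true_and, or_assoc]
  have hAA' : A ≤ A' := by
    rw [← hT]
    exact Algebra.adjoin_mono fun t ht => (hGmem t).mpr (Or.inl ht)
  have hA'O : A'.toSubring ≤ O.toSubring := by
    let O' : Subalgebra k K := { O.toSubring.toSubsemiring with algebraMap_mem' := hk }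
    change A' ≤ O'
    refine Algebra.adjoin_le fun t ht => ?_
    rcases (hGmem t).mp ht with ht | ⟨i, rfl⟩ | ⟨i, rfl⟩ | ⟨i, rfl⟩
    · exact hTO t ht
    · exact hyKO i
    · exact hyKinv i
    · show mK i ∈ O
      rw [← hcomapK]
      exact hmKO i
  have hA'fg : A'.FG := ⟨G, rfl⟩
  have hA'fr : IsFractionRing A' K := by
    haveI := hAfr
    refine IsFractionRing.of_field A' K fun z => ?_
    obtain ⟨a, c, -, rfl⟩ := IsFractionRing.div_surjective (A := A) z
    exact ⟨⟨a, hAA' a.2⟩, ⟨c, hAA' c.2⟩, rfl⟩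
  ------------------------------------------------------------------
  -- Step 6: `N = Nr_{L₁}(A')` and its local ring at the centre
  ------------------------------------------------------------------
  set φ : K →ₐ[k] L₁ := IsScalarTower.toAlgHom k K L₁ with hφ
  obtain ⟨N₀, hN₀int, hN₀fg, hN₀fr, hN₀n⟩ := exists_normalisation_in_extension A' hA'fg hA'fr L₁
  have hmemN₀ : ∀ w : L₁, w ∈ N₀ ↔ IsIntegral (A'.map φ) w := fun w => by
    rw [← SetLike.mem_coe, hN₀int]; rfl
  have hlN₀ : ∀ c : l, (c : L₁) ∈ N₀ := fun c => by
    rw [hmemN₀]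
    have h1 : IsIntegral k (c : L₁) :=
      (Algebra.IsIntegral.isIntegral (R := k) c).map (IsScalarTower.toAlgHom k l L₁)
    exact h1.tower_top
  let N : Subalgebra l L₁ :=
    { carrier := N₀
      mul_mem' := N₀.mul_mem
      one_mem' := N₀.one_mem
      add_mem' := N₀.add_mem
      zero_mem' := N₀.zero_mem
      algebraMap_mem' := hlN₀ }
  have hmemN : ∀ w : L₁, w ∈ N ↔ w ∈ N₀ := fun _ => Iff.rfl
  have hA'LO : (A'.map φ).toSubring ≤ O₁'.toSubring := by
    rintro _ ⟨a, ha, rfl⟩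
    have : (a : K) ∈ O₁'.comap (algebraMap K L₁) := by rw [hcomapK]; exact hA'O ha
    exact this
  have hN : N.toSubring ≤ O₁'.toSubring := fun w hw =>
    mem_of_isIntegral_of_le (V := O₁') (S := (A'.map φ).toSubring) hA'LO ((hmemN₀ w).mp hw)
  have hNn : ∀ w : L₁, IsIntegral N w → w ∈ N := fun w hw => by
    rw [hmemN]
    refine hN₀n w (hw.map_of_comp_eq (RingHom.id _ : N →+* N₀) (RingHom.id L₁) ?_)
    ext; rfl
  set RB := centreLocalRing O₁' NB with hRBdef
  -- (i) `A' ⊆ A_{B,M}`: the generators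
  have hA'R : A'.map φ ≤ RB.restrictScalars k := by
    rw [hA', AlgHom.map_adjoin]
    refine Algebra.adjoin_le ?_
    rintro _ ⟨t, ht, rfl⟩
    rcases (hGmem t).mp ht with ht | ⟨i, rfl⟩ | ⟨i, rfl⟩ | ⟨i, rfl⟩
    · exact hAin (φ t) (Finset.mem_image_of_mem _ ht)
    · exact le_centreLocalRing _ (le_nrAlg _ (coe_mem_toricChart xL yL M i))
    · show φ ((yK i : K)⁻¹) ∈ RB
      rw [map_inv₀]
      exact le_centreLocalRing _ (le_nrAlg _ (inv_coe_mem_toricChart xL yL M i))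
    · show φ (mK i) ∈ RB
      change algebraMap K L₁ (mK i) ∈ RB
      rw [hmKL]
      refine le_centreLocalRing _ (le_nrAlg _ (lmonomial_mem_toricChart xL yL (dI i) ?_))
      exact ⟨Additive.toMul (b i) ^ nI i, M.pow_mem (Submonoid.subset_closure ⟨i, rfl⟩) _, hdI i⟩
  -- (ii) `N ⊆ A_{B,M}` (the local ring of a normal model is integrally closed in `L₁`)
  have hNR : N ≤ RB := by
    intro w hw
    have hwint : IsIntegral (A'.map φ) w := (hmemN₀ w).mp hw
    letI : Algebra (A'.map φ) (RB.restrictScalars k) := (Subalgebra.inclusion hA'R).toRingHom.toAlgebra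
    haveI : IsScalarTower (A'.map φ) (RB.restrictScalars k) L₁ :=
      IsScalarTower.of_algebraMap_eq fun _ => rfl
    have hwR : IsIntegral (RB.restrictScalars k) w := hwint.tower_top
    exact mem_centreLocalRing_of_isIntegral (fun v hv => mem_nrAlg_of_isIntegral_nrAlg hv)
      (hwR.map_of_comp_eq (RingHom.id _ : RB.restrictScalars k →+* RB) (RingHom.id L₁) (by ext; rfl))
  -- (iii) `l[M_B] ⊆ N`: every generator is integral over `A'`
  have hNprod : 0 < ∏ i, nI i := Finset.prod_pos fun i _ => hnI i
  have hCBN : CB ≤ N := by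
    refine Algebra.adjoin_le ?_
    rintro m ((⟨i, rfl⟩ | ⟨i, rfl⟩) | ⟨⟨γ, hγM, hγ⟩, d, rfl⟩)
    · rw [SetLike.mem_coe, hmemN, hmemN₀]
      exact isIntegral_algebraMap (R := A'.map φ)
        (x := ⟨φ (yK i : K), Subalgebra.mem_map.mpr ⟨_, Algebra.subset_adjoin ((hGmem _).mpr
          (Or.inr (Or.inl ⟨i, rfl⟩))), rfl⟩⟩)
    · rw [SetLike.mem_coe, hmemN, hmemN₀]
      have : (yL i : L₁)⁻¹ = φ ((yK i : K)⁻¹) := by rw [map_inv₀]; rfl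
      change IsIntegral _ (yL i : L₁)⁻¹
      rw [this]
      exact isIntegral_algebraMap (R := A'.map φ)
        (x := ⟨φ ((yK i : K)⁻¹), Subalgebra.mem_map.mpr ⟨_, Algebra.subset_adjoin ((hGmem _).mpr
          (Or.inr (Or.inr (Or.inl ⟨i, rfl⟩)))), rfl⟩⟩)
    · -- a monomial `xL^d` with `|xL^d| = γ ∈ M`: `(xL^d)^(∏ nᵢ) ∈ φ(A')`
      rw [SetLike.mem_coe, hmemN, hmemN₀]
      obtain ⟨a, ha⟩ := Submonoid.mem_closure_range_iff_of_fintype.mp hγM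
      let c : Fin n → ℕ := fun i => a i * ∏ j ∈ Finset.univ.erase i, nI j
      have hc : ∀ i, nI i * c i = a i * ∏ j, nI j := fun i => by
        simp only [c]
        rw [← Finset.mul_prod_erase Finset.univ nI (Finset.mem_univ i)]
        ring
      have hval : O₁'.valuation ((((∏ i, nI i) • d).prod fun j (n : ℤ) => xL j ^ n)) =
          O₁'.valuation ((∑ i, c i • dI i).prod fun j (n : ℤ) => xL j ^ n) := by
        rw [lmonomial_nsmul xL hBK.ne_zero, map_pow, ← hγ, ha, lmonomial_sum xL hBK.ne_zero,
          map_prod]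
        simp only [lmonomial_nsmul xL hBK.ne_zero, map_pow, ← hdI]
        push_cast
        rw [← Finset.prod_pow]
        refine Finset.prod_congr rfl fun i _ => ?_
        rw [← pow_mul, ← pow_mul, hc i, mul_comm]
      have hdeq : (∏ i, nI i) • d = ∑ i, c i • dI i :=
        valuation_lmonomial_injective O₁' xL hBK.ne_zero hBK.linearIndependent hval
      have hpow : (d.prod fun j (n : ℤ) => xL j ^ n) ^ (∏ i, nI i) = φ (∏ i, mK i ^ c i) := by
        rw [← lmonomial_nsmul xL hBK.ne_zero, hdeq, lmonomial_sum xL hBK.ne_zero, map_prod]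
        refine Finset.prod_congr rfl fun i _ => ?_
        rw [lmonomial_nsmul xL hBK.ne_zero, map_pow]
        congr 1
        exact (hmKL i).symm
      refine IsIntegral.of_pow hNprod ?_
      rw [hpow]
      refine isIntegral_algebraMap (R := A'.map φ) (x := ⟨φ (∏ i, mK i ^ c i),
        Subalgebra.mem_map.mpr ⟨_, ?_, rfl⟩⟩)
      exact A'.prod_mem fun i _ => A'.pow_mem (Algebra.subset_adjoin ((hGmem _).mpr
        (Or.inr (Or.inr (Or.inr ⟨i, rfl⟩))))) _
  have hNBN : NB ≤ N := by
    intro w hw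
    letI : Algebra CB N := (Subalgebra.inclusion hCBN).toRingHom.toAlgebra
    haveI : IsScalarTower CB N L₁ := IsScalarTower.of_algebraMap_eq fun _ => rfl
    exact hNn w ((mem_nrAlg_iff.mp hw).tower_top)
  have hRR : centreLocalRing O₁' N = RB := by
    refine le_antisymm ?_ (centreLocalRing_mono hNBN)
    calc centreLocalRing O₁' N ≤ centreLocalRing O₁' RB := centreLocalRing_mono hNR
      _ = RB := centreLocalRing_centreLocalRing O₁' NB
  ------------------------------------------------------------------
  -- Step 7: conclusion
  ------------------------------------------------------------------
  have hsmN : Algebra.IsSmoothAt l (centreIdeal N O₁' hN) := isSmoothAt_centreIdeal_of_eq hRR hsmB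
  have hsepN : Algebra.FormallySmooth l (centreIdeal N O₁' hN).ResidueField :=
    formallySmooth_residueField_centreIdeal_of_eq hRR hsepB
  have hNfg : N.FG := by
    obtain ⟨G', hG'⟩ := hN₀fg
    refine ⟨G', le_antisymm (Algebra.adjoin_le fun w hw => ?_) fun w hw => ?_⟩
    · rw [SetLike.mem_coe, hmemN, ← hG']
      exact Algebra.subset_adjoin hw
    · have hw' : w ∈ Algebra.adjoin k (G' : Set L₁) := by rw [hG']; exact hw
      exact (Algebra.adjoin_le (S := (Algebra.adjoin l (G' : Set L₁)).restrictScalars k)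
        Algebra.subset_adjoin) hw'
  have hNfgk : (N.restrictScalars k).FG := by
    have : N.restrictScalars k = N₀ := SetLike.ext fun w => Iff.rfl
    rw [this]; exact hN₀fg
  have hNfr : IsFractionRing N L₁ := by
    haveI := hN₀fr
    refine IsFractionRing.of_field N L₁ fun z => ?_
    obtain ⟨a, c, -, rfl⟩ := IsFractionRing.div_surjective (A := N₀) z
    exact ⟨⟨a, a.2⟩, ⟨c, c.2⟩, rfl⟩
  have hregN : IsRegularLocalRing (Localization.AtPrime (centreIdeal N O₁' hN)) := by
    haveI : Algebra.FiniteType l N := N.fg_iff_finiteType.mp hNfg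
    haveI : Algebra.FinitePresentation l N :=
      (Algebra.FinitePresentation.of_finiteType (R := l) (A := N)).mp inferInstance
    haveI := hsmN
    exact isRegularLocalRing_of_isSmoothAt l N _
  have hNint : (N : Set L₁) = {w : L₁ | IsIntegral (A'.map (IsScalarTower.toAlgHom k K L₁)) w} := hN₀int
  exact ⟨L₁, inferInstance, inferInstance, inferInstance, inferInstance, inferInstance,
    inferInstance, hfinL, hpiL, l, hlfin, hlpi, hlK₁, A', hAA', hA'O, hA'fg, hA'fr, O₁', hO₁',
    N, hN, hNint, hNfgk, hNfr, hsmN, hsepN, hregN⟩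

/-! ### The new frontier -/

/-- **The induction base of Thm. 4.1.1 (`Temkin2013DescentAbhyankar`) from §5**: Thm. 5.5.3 and
Thm. 5.5.1 (iii) (with the proved Prop. 5.4.3, Cor. 5.4.2, Thm. A.2.1) imply descent inseparable
local uniformization of Abhyankar valuations (via `Temkin2013Abhyankar.descentAbhyankar`, proof of
Thm. 4.1.1, Step 0, p. 47). [cite: Temkin2013, proof of Thm. 4.1.1, Step 0 (p. 47) and Thm. 5.5.2 (i) (p. 60)] -/
theorem Temkin2013DescentAbhyankar.of_section5 (h553 : Temkin2013_Thm553.{u})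
    (h551 : Temkin2013_Thm551iii.{u}) : Temkin2013DescentAbhyankar.{u} :=
  (Temkin2013Abhyankar.of_section5 h553 h551).descentAbhyankar

/-- Thm. 4.1.1 (`n = 1`, non-logarithmic form) from Thm. 5.5.3, Thm. 5.5.1 (iii) and the induction
step on the transcendence defect. [cite: Temkin2013, proof of Thm. 4.1.1 (pp. 47–50)] -/
theorem Temkin2013Descent.of_section5 (h553 : Temkin2013_Thm553.{u})
    (h551 : Temkin2013_Thm551iii.{u}) (hs : Temkin2013DescentDefectStep.{u}) :
    Temkin2013Descent.{u} :=
  Temkin2013Descent.of_abhyankar (Temkin2013Abhyankar.of_section5 h553 h551) hs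

/-- **Frontier of the corrected Thm. 1.3.2**: `Temkin2013Relative` follows from Thm. 5.5.3,
Thm. 5.5.1 (iii), the induction step on the transcendence defect (§4.1, Steps 1–4) and the induction
step on the height (§4.2) — four statements printed in the paper with their own numbers; the
assembly of §5 (Thm. 5.5.2 with Prop. 5.4.3, Cor. 5.4.2, Thm. A.2.1) is proved.
[cite: Temkin2013, Sections 4–5] -/
theorem Temkin2013Relative.of_section5_frontier (h553 : Temkin2013_Thm553.{u})
    (h551 : Temkin2013_Thm551iii.{u}) (hs : Temkin2013DescentDefectStep.{u})
    (hh : Temkin2013HeightStepOfDescent.{u}) : Temkin2013Relative.{u} :=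
  Temkin2013Relative.of_abhyankar_frontier (Temkin2013Abhyankar.of_section5 h553 h551) hs hh

/-- … hence the weak absolute form `Temkin2013` used by the routes. [cite: Temkin2013, Thm. 1.3.2] -/
theorem Temkin2013.of_section5_frontier (h553 : Temkin2013_Thm553.{u})
    (h551 : Temkin2013_Thm551iii.{u}) (hs : Temkin2013DescentDefectStep.{u})
    (hh : Temkin2013HeightStepOfDescent.{u}) : Temkin2013.{u} :=
  Temkin2013.of_abhyankar_frontier (Temkin2013Abhyankar.of_section5 h553 h551) hs hh

/-- The height-`≤ 1` case (Thm. 1.3.2 in height `≤ 1`) from Thm. 5.5.3, Thm. 5.5.1 (iii) and the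
defect step alone. [cite: Temkin2013, Section 4.1] -/
theorem Temkin2013HeightLeOne.of_section5_frontier (h553 : Temkin2013_Thm553.{u})
    (h551 : Temkin2013_Thm551iii.{u}) (hs : Temkin2013DescentDefectStep.{u}) :
    Temkin2013HeightLeOne.{u} :=
  Temkin2013HeightLeOne.of_abhyankar_frontier (Temkin2013Abhyankar.of_section5 h553 h551) hs

end Literature.AlgebraicGeometry.Resolution
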